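import Literature.NumberTheory.Automorphic.HermitianLatticeTreeTransitiveRamifiedFlags   -- ★ (r1-C part 2): `isSelfDualLattice_latt_diagonal_antidiag`, `isModularLattice_latt_diagonal_antidiag`, tree files
import HarnessLib

/-!
# The standard apartment of the lattice tree of the hyperbolic plane `Φ = antidiag(1, 1)`: the diagonal lattices `latt diag(ϖ^a, ϖ^{−a})` (self-dual) and
# `latt diag(ϖ^a, ϖ^{1−a})` (`ϖ`-modular), the translation `t = diag(ϖ, (σϖ)⁻¹)` and the diagonal torus (Serre 1980, II.1.1; Bruhat–Tits 1972, §10)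

Topic `NumberTheory/Automorphic`; namespace `Literature.NumberTheory.Automorphic.HermitianLatticeTree`.  THEOREMS ONLY (no definition, no instance, no notation, no named fact,
no `sorry`).  Cell `pub/hodgecm-mathlib`, F0∕P3a, crux H413 = stmt-HodgeConjecture-24833, line «N6nsGerm», (R2) Euler–Poincaré road, RAMIFIED half, step (S7a) of census
`F0/P3a/A-p06/g27/CENSUS-R2ram-RamifiedEulerPoincare.A-p06g27.md` (LEAD F0P3a-plan (g10) T9-8 (B); seat A-p06 (g27)).  Consumer: (S7b) the period count «per period of the
translation, fixed vertices = fixed edges» (★ p843004 `TreeRetraction.exists_retraction`, ★ p843003 `natCard_quotient_tube`, ★ p843347) and the (S8) `hN` assembly of ★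
`RankOneEulerPoincareGlue`.  HONEST LABEL: HC_CM is proved only modulo the 2 remaining named inputs (hLiu418, h413) until rung 0 closes.

* §1 (lattice level, any valued field, `ϖ` uniformizing): `latt_diagonal_eq_of_valuation_eq` (a diagonal lattice depends only on the valuations of the entries),
  `mapGL_latt_eq`, `coe_inv_of_coe_eq_diagonal`, `latt_diagonal_zpow_le_iff` ∕ `latt_diagonal_zpow_eq_iff`, `scaleLattice_uniformizer_latt_diagonal_zpow`,
  **`mapGL_latt_diagonal_zpow_of_coe_eq_translation`** (`t = diag(ϖ, (σϖ)⁻¹)` moves `latt diag(ϖ^a, ϖ^b)` to `latt diag(ϖ^{a+1}, ϖ^{b−1})`), `…_of_coe_eq_translation_inv`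
  (`t⁻¹`: `(a, b) ↦ (a−1, b+1)`), **`mapGL_latt_diagonal_zpow_of_valuation_eq_one`** (a diagonal element with unit entries fixes every `latt diag(ϖ^a, ϖ^b)`).
* §2 (vertex level, `Φ = !![0,1;1,0]`, `σ` valuation-preserving, `𝒪` a DVR): adjacency along the apartment (`latticeTree_adj_of_eq_selfDual_modular`,
  `latticeTree_adj_of_eq_modular_selfDual_pred`) and its converse `eq_or_eq_of_latticeTree_adj_apartment`; **`connected_induce_apartment`**; the iterates
  **`coe_latticeTreePerm_zpow_apply_of_eq_latt_diagonal`** (`(perm t)^n` moves `latt diag(ϖ^a, ϖ^b)` to `latt diag(ϖ^{a+n}, ϖ^{b−n})`, `n ∈ ℤ`).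

## References
* [Serre1980Trees] J.-P. Serre, *Trees* (1980), II.1.1 (the tree of a local field; apartments = lattices `diag(π^a, π^b)`), I.6.4 (axis of a hyperbolic automorphism).
* [BruhatTits1972] F. Bruhat, J. Tits, *Groupes réductifs sur un corps local I*, Publ. IHÉS 41 (1972), §10 (rank one), §7.4 (apartments).
-/

set_option autoImplicit false

noncomputable section

open NumberField IsDedekindDomain
open scoped Matrix ValuativeRel MatrixGroups
open Matrix ValuativeRel

namespace Literature.NumberTheory.Automorphic.HermitianLatticeTree

open Literature.NumberTheory.Automorphic Literature.NumberTheory.Automorphic.UnitaryGroup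

/-! ## §1 Diagonal lattices -/

section Lattices

variable {E : Type*} [Field E] [ValuativeRel E]

/-- **A diagonal lattice depends only on the valuations of the diagonal entries**: `latt diag(d′) = latt diag(d)` when `|d′ᵢ| = |dᵢ|` (★ `mem_latt_diagonal_iff`).
[cite: Serre1980Trees, II.1.1] -/
theorem latt_diagonal_eq_of_valuation_eq {d d' : Fin 2 → E} (hd : ∀ i, d i ≠ 0) (hd' : ∀ i, d' i ≠ 0)
    (h : ∀ i, valuation E (d' i) = valuation E (d i)) : latt (Matrix.diagonal d') = latt (Matrix.diagonal d) := by
  ext x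
  rw [mem_latt_diagonal_iff hd', mem_latt_diagonal_iff hd]
  refine forall_congr' fun i => ?_
  rw [Valuation.mem_integer_iff, Valuation.mem_integer_iff, map_mul, map_mul, map_inv₀, map_inv₀, h i]

/-- `g · latt D = latt (g D)` for a matrix `D`. [cite: Serre1980Trees, II.1.1] -/
theorem mapGL_latt_eq (g : GL (Fin 2) E) (D : Matrix (Fin 2) (Fin 2) E) : mapGL g (latt D) = latt ((g : Matrix (Fin 2) (Fin 2) E) * D) := by
  rw [mapGL, latt_mul]

omit [ValuativeRel E] in
/-- The inverse of a diagonal element of `GL₂(E)` is the diagonal of the inverses. [cite: Serre1980Trees, II.1.1] -/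
theorem coe_inv_of_coe_eq_diagonal {g : GL (Fin 2) E} {c : Fin 2 → E} (hg : (g : Matrix (Fin 2) (Fin 2) E) = Matrix.diagonal c) (hc : ∀ i, c i ≠ 0) :
    ((g⁻¹ : GL (Fin 2) E) : Matrix (Fin 2) (Fin 2) E) = Matrix.diagonal fun i => (c i)⁻¹ := by
  rw [Matrix.coe_units_inv, hg]
  refine Matrix.inv_eq_left_inv ?_
  rw [Matrix.diagonal_mul_diagonal, ← Matrix.diagonal_one]
  congr 1
  funext i
  exact inv_mul_cancel₀ (hc i)

variable {ϖ : E} (hϖ : IsUniformizingElement ϖ)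

include hϖ in
/-- ORDER along the apartment: `latt diag(ϖ^a, ϖ^b) ≤ latt diag(ϖ^{a′}, ϖ^{b′}) ↔ a′ ≤ a ∧ b′ ≤ b`. [cite: Serre1980Trees, II.1.1] -/
theorem latt_diagonal_zpow_le_iff (a b a' b' : ℤ) :
    latt (Matrix.diagonal ![ϖ ^ a, ϖ ^ b]) ≤ latt (Matrix.diagonal ![ϖ ^ a', ϖ ^ b']) ↔ a' ≤ a ∧ b' ≤ b := by
  have h := latt_mul_diagonal_le_iff hϖ (1 : GL (Fin 2) E) a b a' b'
  rwa [Units.val_one, Matrix.one_mul, Matrix.one_mul] at h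

include hϖ in
/-- INJECTIVITY along the apartment: `latt diag(ϖ^a, ϖ^b) = latt diag(ϖ^{a′}, ϖ^{b′}) ↔ a = a′ ∧ b = b′`. [cite: Serre1980Trees, II.1.1] -/
theorem latt_diagonal_zpow_eq_iff (a b a' b' : ℤ) :
    latt (Matrix.diagonal ![ϖ ^ a, ϖ ^ b]) = latt (Matrix.diagonal ![ϖ ^ a', ϖ ^ b']) ↔ a = a' ∧ b = b' := by
  constructor
  · intro h
    have h₁ := (latt_diagonal_zpow_le_iff hϖ a b a' b').1 h.le
    have h₂ := (latt_diagonal_zpow_le_iff hϖ a' b' a b).1 h.ge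
    omega
  · rintro ⟨rfl, rfl⟩
    rfl

include hϖ in
/-- SCALING along the apartment: `ϖ · latt diag(ϖ^a, ϖ^b) = latt diag(ϖ^{a+1}, ϖ^{b+1})`. [cite: Serre1980Trees, II.1.1] -/
theorem scaleLattice_uniformizer_latt_diagonal_zpow (a b : ℤ) :
    scaleLattice ϖ (latt (Matrix.diagonal ![ϖ ^ a, ϖ ^ b])) = latt (Matrix.diagonal ![ϖ ^ (a + 1), ϖ ^ (b + 1)]) := by
  have h := scaleLattice_zpow_latt_mul_diagonal hϖ (1 : GL (Fin 2) E) a b 1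
  rwa [Units.val_one, Matrix.one_mul, Matrix.one_mul, zpow_one] at h

include hϖ in
/-- The entries `ϖ^a, ϖ^b` are non-zero. [cite: Serre1980Trees, II.1.1] -/
theorem diagonal_zpow_ne_zero (a b : ℤ) : ∀ i, (![ϖ ^ a, ϖ ^ b] : Fin 2 → E) i ≠ 0 := by
  rw [Fin.forall_fin_two]
  exact ⟨zpow_ne_zero a hϖ.ne_zero, zpow_ne_zero b hϖ.ne_zero⟩

variable (σ : E →+* E) (hσv : ∀ x : E, valuation E (σ x) = valuation E x)

include hσv hϖ in
/-- **THE TRANSLATION `t = diag(ϖ, (σϖ)⁻¹)` SHIFTS THE APARTMENT**: `t · latt diag(ϖ^a, ϖ^b) = latt diag(ϖ^{a+1}, ϖ^{b−1})`. [cite: Serre1980Trees, II.1.1; I.6.4] -/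
theorem mapGL_latt_diagonal_zpow_of_coe_eq_translation {t : GL (Fin 2) E} (ht : (t : Matrix (Fin 2) (Fin 2) E) = Matrix.diagonal ![ϖ, (σ ϖ)⁻¹]) (a b : ℤ) :
    mapGL t (latt (Matrix.diagonal ![ϖ ^ a, ϖ ^ b])) = latt (Matrix.diagonal ![ϖ ^ (a + 1), ϖ ^ (b - 1)]) := by
  have hϖ0 := hϖ.ne_zero
  have hσϖ0 : σ ϖ ≠ 0 := (map_ne_zero σ).2 hϖ0
  have hvϖ : valuation E ϖ ≠ 0 := (Valuation.ne_zero_iff _).2 hϖ0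
  rw [mapGL_latt_eq, ht, Matrix.diagonal_mul_diagonal]
  refine latt_diagonal_eq_of_valuation_eq (diagonal_zpow_ne_zero hϖ (a + 1) (b - 1)) ?_ ?_
  · rw [Fin.forall_fin_two]
    exact ⟨mul_ne_zero hϖ0 (zpow_ne_zero a hϖ0), mul_ne_zero (inv_ne_zero hσϖ0) (zpow_ne_zero b hϖ0)⟩
  · rw [Fin.forall_fin_two]
    constructor
    · show valuation E (ϖ * ϖ ^ a) = valuation E (ϖ ^ (a + 1))
      rw [zpow_add_one₀ hϖ0, mul_comm]
    · show valuation E ((σ ϖ)⁻¹ * ϖ ^ b) = valuation E (ϖ ^ (b - 1))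
      rw [map_mul, map_inv₀, hσv, map_zpow₀, map_zpow₀, zpow_sub_one₀ hvϖ, mul_comm]

include hσv hϖ in
/-- … and `t⁻¹ = diag(ϖ⁻¹, σϖ)` shifts it back: `t⁻¹ · latt diag(ϖ^a, ϖ^b) = latt diag(ϖ^{a−1}, ϖ^{b+1})`. [cite: Serre1980Trees, II.1.1; I.6.4] -/
theorem mapGL_latt_diagonal_zpow_of_coe_eq_translation_inv {t : GL (Fin 2) E} (ht : (t : Matrix (Fin 2) (Fin 2) E) = Matrix.diagonal ![ϖ, (σ ϖ)⁻¹]) (a b : ℤ) :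
    mapGL t⁻¹ (latt (Matrix.diagonal ![ϖ ^ a, ϖ ^ b])) = latt (Matrix.diagonal ![ϖ ^ (a - 1), ϖ ^ (b + 1)]) := by
  have hϖ0 := hϖ.ne_zero
  have hσϖ0 : σ ϖ ≠ 0 := (map_ne_zero σ).2 hϖ0
  have hvϖ : valuation E ϖ ≠ 0 := (Valuation.ne_zero_iff _).2 hϖ0
  have hc : ∀ i, (![ϖ, (σ ϖ)⁻¹] : Fin 2 → E) i ≠ 0 := by
    rw [Fin.forall_fin_two]; exact ⟨hϖ0, inv_ne_zero hσϖ0⟩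
  rw [mapGL_latt_eq, coe_inv_of_coe_eq_diagonal ht hc, Matrix.diagonal_mul_diagonal]
  refine latt_diagonal_eq_of_valuation_eq (diagonal_zpow_ne_zero hϖ (a - 1) (b + 1)) ?_ ?_
  · rw [Fin.forall_fin_two]
    exact ⟨mul_ne_zero (inv_ne_zero hϖ0) (zpow_ne_zero a hϖ0), mul_ne_zero (inv_ne_zero (inv_ne_zero hσϖ0)) (zpow_ne_zero b hϖ0)⟩
  · rw [Fin.forall_fin_two]
    constructor
    · show valuation E (ϖ⁻¹ * ϖ ^ a) = valuation E (ϖ ^ (a - 1))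
      rw [map_mul, map_inv₀, map_zpow₀, map_zpow₀, zpow_sub_one₀ hvϖ, mul_comm]
    · show valuation E (((σ ϖ)⁻¹)⁻¹ * ϖ ^ b) = valuation E (ϖ ^ (b + 1))
      rw [inv_inv, map_mul, hσv, map_zpow₀, map_zpow₀, zpow_add_one₀ hvϖ, mul_comm]

include hϖ in
/-- **THE DIAGONAL TORUS FIXES THE APARTMENT POINTWISE**: a diagonal `γ` with unit entries has `γ · latt diag(ϖ^a, ϖ^b) = latt diag(ϖ^a, ϖ^b)`.
[cite: Serre1980Trees, II.1.1] [cite: BruhatTits1972, §7.4] -/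
theorem mapGL_latt_diagonal_zpow_of_valuation_eq_one {γ : GL (Fin 2) E} {e : Fin 2 → E} (hγ : (γ : Matrix (Fin 2) (Fin 2) E) = Matrix.diagonal e)
    (he : ∀ i, valuation E (e i) = 1) (a b : ℤ) :
    mapGL γ (latt (Matrix.diagonal ![ϖ ^ a, ϖ ^ b])) = latt (Matrix.diagonal ![ϖ ^ a, ϖ ^ b]) := by
  have hϖ0 := hϖ.ne_zero
  have he0 : ∀ i, e i ≠ 0 := fun i h0 => by have h := he i; rw [h0, map_zero] at h; exact zero_ne_one h
  rw [mapGL_latt_eq, hγ, Matrix.diagonal_mul_diagonal]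
  refine latt_diagonal_eq_of_valuation_eq (diagonal_zpow_ne_zero hϖ a b) (fun i => mul_ne_zero (he0 i) (diagonal_zpow_ne_zero hϖ a b i)) fun i => ?_
  rw [map_mul, he i, one_mul]

end Lattices

/-! ## §2 The apartment inside the lattice tree of `Φ = antidiag(1,1)` -/

section Vertices

variable {E : Type*} [Field E] [ValuativeRel E] (σ : E →+* E) (hσv : ∀ x : E, valuation E (σ x) = valuation E x)
  {ϖ : E} (hϖ : IsUniformizingElement ϖ)

include hσv hϖ in
/-- The apartment vertices of SUM ZERO are self-dual: `latt diag(ϖ^a, ϖ^b)`, `a + b = 0`. [cite: Serre1980Trees, II.1.1] [cite: BruhatTits1972, §10] -/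
theorem isSelfDualLattice_latt_diagonal_zpow {a b : ℤ} (hab : a + b = 0) :
    IsSelfDualLattice σ (!![0, 1; 1, 0] : Matrix (Fin 2) (Fin 2) E) (latt (Matrix.diagonal ![ϖ ^ a, ϖ ^ b])) := by
  obtain rfl : b = -a := by omega
  exact isSelfDualLattice_latt_diagonal_antidiag σ hσv hϖ a

include hσv hϖ in
/-- The apartment vertices of SUM ONE are `ϖ`-modular: `latt diag(ϖ^a, ϖ^b)`, `a + b = 1`. [cite: Serre1980Trees, II.1.1] [cite: BruhatTits1972, §10] -/
theorem isModularLattice_latt_diagonal_zpow {a b : ℤ} (hab : a + b = 1) :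
    IsModularLattice σ ϖ (!![0, 1; 1, 0] : Matrix (Fin 2) (Fin 2) E) (latt (Matrix.diagonal ![ϖ ^ a, ϖ ^ b])) := by
  obtain rfl : b = 1 - a := by omega
  exact isModularLattice_latt_diagonal_antidiag σ hσv hϖ a

include hσv hϖ in
/-- **ADJACENCY ALONG THE APARTMENT**: the self-dual `latt diag(ϖ^a, ϖ^b)` (`a + b = 0`) is adjacent to the `ϖ`-modular `latt diag(ϖ^a, ϖ^{b+1})` and `latt diag(ϖ^{a+1}, ϖ^b)`.
[cite: Serre1980Trees, II.1.1] [cite: BruhatTits1972, §10] -/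
theorem latticeTree_adj_apartment {a b a' b' : ℤ} (hab : a + b = 0) (h : a' = a ∧ b' = b + 1 ∨ a' = a + 1 ∧ b' = b)
    (v w : {M : Submodule 𝒪[E] (Fin 2 → E) // IsSpecialLattice σ ϖ (!![0, 1; 1, 0] : Matrix (Fin 2) (Fin 2) E) M}) (hv : v.1 = latt (Matrix.diagonal ![ϖ ^ a, ϖ ^ b])) (hw : w.1 = latt (Matrix.diagonal ![ϖ ^ a', ϖ ^ b'])) :
    (latticeTree σ ϖ (!![0, 1; 1, 0] : Matrix (Fin 2) (Fin 2) E)).Adj v w := by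
  rw [latticeTree_adj_iff]
  refine ⟨fun hvw => ?_, Or.inl ⟨hv ▸ isSelfDualLattice_latt_diagonal_zpow σ hσv hϖ hab, hw ▸ isModularLattice_latt_diagonal_zpow σ hσv hϖ (by omega), ?_, ?_⟩⟩
  · have he := (latt_diagonal_zpow_eq_iff hϖ a b a' b').1 (by rw [← hv, ← hw, hvw])
    omega
  · rw [hv, hw, scaleLattice_uniformizer_latt_diagonal_zpow hϖ, latt_diagonal_zpow_le_iff hϖ]
    omega
  · rw [hv, hw, latt_diagonal_zpow_le_iff hϖ]
    omega

include hσv hϖ in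
/-- **… and these are its only neighbours in the apartment**: if the `ϖ`-modular `latt diag(ϖ^{a′}, ϖ^{b′})` (`a′ + b′ = 1`) is adjacent to the self-dual
`latt diag(ϖ^a, ϖ^b)` (`a + b = 0`) then `(a′, b′) = (a, b+1)` or `(a+1, b)`. [cite: Serre1980Trees, II.1.1] [cite: BruhatTits1972, §10] -/
theorem eq_or_eq_of_latticeTree_adj_apartment {a b a' b' : ℤ} (hab : a + b = 0) (hab' : a' + b' = 1)
    (v w : {M : Submodule 𝒪[E] (Fin 2 → E) // IsSpecialLattice σ ϖ (!![0, 1; 1, 0] : Matrix (Fin 2) (Fin 2) E) M}) (hv : v.1 = latt (Matrix.diagonal ![ϖ ^ a, ϖ ^ b])) (hw : w.1 = latt (Matrix.diagonal ![ϖ ^ a', ϖ ^ b']))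
    (hadj : (latticeTree σ ϖ (!![0, 1; 1, 0] : Matrix (Fin 2) (Fin 2) E)).Adj v w ∨ (latticeTree σ ϖ (!![0, 1; 1, 0] : Matrix (Fin 2) (Fin 2) E)).Adj w v) :
    a' = a ∧ b' = b + 1 ∨ a' = a + 1 ∧ b' = b := by
  have hvs : IsSelfDualLattice σ (!![0, 1; 1, 0] : Matrix (Fin 2) (Fin 2) E) v.1 := hv ▸ isSelfDualLattice_latt_diagonal_zpow σ hσv hϖ hab
  have hle : w.1 ≤ v.1 := by
    rcases hadj with h | h
    · rcases (latticeTree_adj_iff σ ϖ _ v w).1 h with ⟨-, ⟨-, -, -, h4⟩ | ⟨-, h2, -, -⟩⟩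
      · exact h4
      · exact absurd h2 (fun h2 => not_isModularLattice_of_isSelfDualLattice σ hσv hϖ _ hvs h2)
    · rcases (latticeTree_adj_iff σ ϖ _ w v).1 h with ⟨-, ⟨-, h2, -, -⟩ | ⟨-, -, -, h4⟩⟩
      · exact absurd h2 (fun h2 => not_isModularLattice_of_isSelfDualLattice σ hσv hϖ _ hvs h2)
      · exact h4
  rw [hv, hw, latt_diagonal_zpow_le_iff hϖ] at hle
  omega

include hσv hϖ in
/-- **THE APARTMENT IS CONNECTED** (as an induced subgraph of the tree): it is the two-way infinite path
`… — diag(ϖ^{a−1},ϖ^{1−a}) — diag(ϖ^a,ϖ^{1−a}) — diag(ϖ^a,ϖ^{−a}) — diag(ϖ^{a+1},ϖ^{−a}) — …`. [cite: Serre1980Trees, II.1.1; I.6.4] [cite: BruhatTits1972, §7.4] -/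
theorem connected_induce_apartment [IsDiscreteValuationRing 𝒪[E]] (Y : Set {M : Submodule 𝒪[E] (Fin 2 → E) // IsSpecialLattice σ ϖ (!![0, 1; 1, 0] : Matrix (Fin 2) (Fin 2) E) M})
    (hY : ∀ v : {M : Submodule 𝒪[E] (Fin 2 → E) // IsSpecialLattice σ ϖ (!![0, 1; 1, 0] : Matrix (Fin 2) (Fin 2) E) M}, v ∈ Y ↔ ∃ a b : ℤ, (a + b = 0 ∨ a + b = 1) ∧ v.1 = latt (Matrix.diagonal ![ϖ ^ a, ϖ ^ b])) :
    ((latticeTree σ ϖ (!![0, 1; 1, 0] : Matrix (Fin 2) (Fin 2) E)).induce Y).Connected := by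
  -- the vertices of the path
  have hspA : ∀ a b : ℤ, a + b = 0 → IsSpecialLattice σ ϖ (!![0, 1; 1, 0] : Matrix (Fin 2) (Fin 2) E) (latt (Matrix.diagonal ![ϖ ^ a, ϖ ^ b])) :=
    fun a b h => Or.inl (isSelfDualLattice_latt_diagonal_zpow σ hσv hϖ h)
  have hspB : ∀ a b : ℤ, a + b = 1 → IsSpecialLattice σ ϖ (!![0, 1; 1, 0] : Matrix (Fin 2) (Fin 2) E) (latt (Matrix.diagonal ![ϖ ^ a, ϖ ^ b])) :=
    fun a b h => Or.inr (isModularLattice_latt_diagonal_zpow σ hσv hϖ h)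
  have hmemA : ∀ (a b : ℤ) (h : a + b = 0), (⟨latt (Matrix.diagonal ![ϖ ^ a, ϖ ^ b]), hspA a b h⟩ : {M : Submodule 𝒪[E] (Fin 2 → E) // IsSpecialLattice σ ϖ (!![0, 1; 1, 0] : Matrix (Fin 2) (Fin 2) E) M}) ∈ Y :=
    fun a b h => (hY _).2 ⟨a, b, Or.inl h, rfl⟩
  have hmemB : ∀ (a b : ℤ) (h : a + b = 1), (⟨latt (Matrix.diagonal ![ϖ ^ a, ϖ ^ b]), hspB a b h⟩ : {M : Submodule 𝒪[E] (Fin 2 → E) // IsSpecialLattice σ ϖ (!![0, 1; 1, 0] : Matrix (Fin 2) (Fin 2) E) M}) ∈ Y :=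
    fun a b h => (hY _).2 ⟨a, b, Or.inr h, rfl⟩
  -- adjacency inside the induced graph
  have hadjI : ∀ (x y : Y) (a b a' b' : ℤ), a + b = 0 → (a' = a ∧ b' = b + 1 ∨ a' = a + 1 ∧ b' = b) →
      (x : {M : Submodule 𝒪[E] (Fin 2 → E) // IsSpecialLattice σ ϖ (!![0, 1; 1, 0] : Matrix (Fin 2) (Fin 2) E) M}).1 = latt (Matrix.diagonal ![ϖ ^ a, ϖ ^ b]) → (y : {M : Submodule 𝒪[E] (Fin 2 → E) // IsSpecialLattice σ ϖ (!![0, 1; 1, 0] : Matrix (Fin 2) (Fin 2) E) M}).1 = latt (Matrix.diagonal ![ϖ ^ a', ϖ ^ b']) →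
      ((latticeTree σ ϖ (!![0, 1; 1, 0] : Matrix (Fin 2) (Fin 2) E)).induce Y).Adj x y :=
    fun x y a b a' b' hab h hx hy => latticeTree_adj_apartment σ hσv hϖ hab h x y hx hy
  -- the base point and the self-dual spine
  set x₀ : Y := ⟨⟨latt (Matrix.diagonal ![ϖ ^ (0 : ℤ), ϖ ^ (0 : ℤ)]), hspA 0 0 (by norm_num)⟩, hmemA 0 0 (by norm_num)⟩ with hx₀
  have hspine : ∀ a : ℤ, ((latticeTree σ ϖ (!![0, 1; 1, 0] : Matrix (Fin 2) (Fin 2) E)).induce Y).Reachable x₀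
      ⟨⟨latt (Matrix.diagonal ![ϖ ^ a, ϖ ^ (-a)]), hspA a (-a) (by omega)⟩, hmemA a (-a) (by omega)⟩ := by
    intro a
    induction a using Int.induction_on with
    | zero => exact SimpleGraph.Reachable.refl _
    | succ n ih =>
      -- `SD(n,−n) — MOD(n+1,−n) — SD(n+1,−(n+1))`
      refine ih.trans ((SimpleGraph.Adj.reachable (hadjI _ ⟨⟨latt (Matrix.diagonal ![ϖ ^ ((n : ℤ) + 1), ϖ ^ (-(n : ℤ))]),
        hspB _ _ (by omega)⟩, hmemB _ _ (by omega)⟩ n (-n) (n + 1) (-n) (by omega) (Or.inr ⟨rfl, rfl⟩) rfl rfl)).trans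
        (SimpleGraph.Adj.reachable (hadjI _ _ ((n : ℤ) + 1) (-((n : ℤ) + 1)) (n + 1) (-n) (by omega) (Or.inl ⟨rfl, by omega⟩) rfl rfl)).symm)
    | pred n ih =>
      -- `SD(−n,n) — MOD(−n,n+1) — SD(−n−1,n+1)`
      refine ih.trans ((SimpleGraph.Adj.reachable (hadjI _ ⟨⟨latt (Matrix.diagonal ![ϖ ^ (-(n : ℤ)), ϖ ^ ((n : ℤ) + 1)]),
        hspB _ _ (by omega)⟩, hmemB _ _ (by omega)⟩ (-n) (-(-(n : ℤ))) (-n) (n + 1) (by omega) (Or.inl ⟨rfl, by omega⟩) rfl rfl)).trans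
        (SimpleGraph.Adj.reachable (hadjI _ _ (-(n : ℤ) - 1) (-(-(n : ℤ) - 1)) (-n) (n + 1) (by omega) (Or.inr ⟨by omega, by omega⟩) rfl rfl)).symm)
  -- every apartment vertex is reachable from the base point
  have hreach : ∀ y : Y, ((latticeTree σ ϖ (!![0, 1; 1, 0] : Matrix (Fin 2) (Fin 2) E)).induce Y).Reachable x₀ y := by
    intro y
    obtain ⟨a, b, hab, hy⟩ := (hY y).1 y.2
    rcases hab with hab | hab
    · obtain rfl : b = -a := by omega
      have heq : y = ⟨⟨latt (Matrix.diagonal ![ϖ ^ a, ϖ ^ (-a)]), hspA a (-a) (by omega)⟩, hmemA a (-a) (by omega)⟩ :=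
        Subtype.ext (Subtype.ext hy)
      rw [heq]
      exact hspine a
    · -- `MOD(a,b)` is adjacent to `SD(a, b−1) = SD(a, −a)`
      obtain rfl : b = -a + 1 := by omega
      exact (hspine a).trans (SimpleGraph.Adj.reachable (hadjI _ y a (-a) a (-a + 1) (by omega) (Or.inl ⟨rfl, rfl⟩) rfl hy))
  haveI : Nonempty Y := ⟨x₀⟩
  exact ⟨fun x y => (hreach x).symm.trans (hreach y)⟩

/-! ### The translation and its iterates on the apartment -/

/-- The permutation on underlying lattices: `(latticeTreePerm u v).1 = u · v.1`. [cite: BruhatTits1972, §10] -/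
theorem coe_latticeTreePerm_apply (u : unitaryGroupOfForm σ (!![0, 1; 1, 0] : Matrix (Fin 2) (Fin 2) E)) (v : {M : Submodule 𝒪[E] (Fin 2 → E) // IsSpecialLattice σ ϖ (!![0, 1; 1, 0] : Matrix (Fin 2) (Fin 2) E) M}) :
    ((latticeTreePerm σ ϖ (!![0, 1; 1, 0] : Matrix (Fin 2) (Fin 2) E) u v : {M : Submodule 𝒪[E] (Fin 2 → E) // IsSpecialLattice σ ϖ (!![0, 1; 1, 0] : Matrix (Fin 2) (Fin 2) E) M}) : Submodule 𝒪[E] (Fin 2 → E)) = mapGL (u : GL (Fin 2) E) v.1 := rfl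

/-- … and of its inverse: `((latticeTreePerm u)⁻¹ v).1 = u⁻¹ · v.1`. [cite: BruhatTits1972, §10] -/
theorem coe_latticeTreePerm_inv_apply (u : unitaryGroupOfForm σ (!![0, 1; 1, 0] : Matrix (Fin 2) (Fin 2) E)) (v : {M : Submodule 𝒪[E] (Fin 2 → E) // IsSpecialLattice σ ϖ (!![0, 1; 1, 0] : Matrix (Fin 2) (Fin 2) E) M}) :
    (((latticeTreePerm σ ϖ (!![0, 1; 1, 0] : Matrix (Fin 2) (Fin 2) E) u)⁻¹ v : {M : Submodule 𝒪[E] (Fin 2 → E) // IsSpecialLattice σ ϖ (!![0, 1; 1, 0] : Matrix (Fin 2) (Fin 2) E) M}) : Submodule 𝒪[E] (Fin 2 → E)) = mapGL (u : GL (Fin 2) E)⁻¹ v.1 := rfl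

include hσv hϖ in
/-- **THE ITERATES OF THE TRANSLATION ON THE APARTMENT**: for `t ∈ U(Φ)` with `↑t = diag(ϖ, (σϖ)⁻¹)` and every `n ∈ ℤ`,
`(perm t)^n · latt diag(ϖ^a, ϖ^b) = latt diag(ϖ^{a+n}, ϖ^{b−n})`. [cite: Serre1980Trees, I.6.4; II.1.1] -/
theorem coe_latticeTreePerm_zpow_apply_of_eq_latt_diagonal {t : unitaryGroupOfForm σ (!![0, 1; 1, 0] : Matrix (Fin 2) (Fin 2) E)}
    (ht : ((t : GL (Fin 2) E) : Matrix (Fin 2) (Fin 2) E) = Matrix.diagonal ![ϖ, (σ ϖ)⁻¹]) (n : ℤ) :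
    ∀ (v : {M : Submodule 𝒪[E] (Fin 2 → E) // IsSpecialLattice σ ϖ (!![0, 1; 1, 0] : Matrix (Fin 2) (Fin 2) E) M}) (a b : ℤ), v.1 = latt (Matrix.diagonal ![ϖ ^ a, ϖ ^ b]) →
      (((latticeTreePerm σ ϖ (!![0, 1; 1, 0] : Matrix (Fin 2) (Fin 2) E) t ^ n) v : {M : Submodule 𝒪[E] (Fin 2 → E) // IsSpecialLattice σ ϖ (!![0, 1; 1, 0] : Matrix (Fin 2) (Fin 2) E) M}) : Submodule 𝒪[E] (Fin 2 → E)) = latt (Matrix.diagonal ![ϖ ^ (a + n), ϖ ^ (b - n)]) := by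
  induction n using Int.induction_on with
  | zero =>
    intro v a b hv
    rw [zpow_zero, Equiv.Perm.one_apply, hv, add_zero, sub_zero]
  | succ n ih =>
    intro v a b hv
    rw [_root_.zpow_add_one, Equiv.Perm.mul_apply, ih _ (a + 1) (b - 1), show a + 1 + (n : ℤ) = a + (n + 1) by ring,
      show b - 1 - (n : ℤ) = b - (n + 1) by ring]
    rw [coe_latticeTreePerm_apply, hv, mapGL_latt_diagonal_zpow_of_coe_eq_translation hϖ σ hσv ht]
  | pred n ih =>
    intro v a b hv
    rw [_root_.zpow_sub_one, Equiv.Perm.mul_apply, ih _ (a - 1) (b + 1), show a - 1 + (-(n : ℤ)) = a + (-(n : ℤ) - 1) by ring,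
      show b + 1 - (-(n : ℤ)) = b - (-(n : ℤ) - 1) by ring]
    rw [coe_latticeTreePerm_inv_apply, hv, mapGL_latt_diagonal_zpow_of_coe_eq_translation_inv hϖ σ hσv ht]

include hσv hϖ in
/-- The translation group `⟨perm t⟩ ≤ Perm(V)` PRESERVES each colour class of the apartment (`a + b` is invariant). [cite: Serre1980Trees, I.6.4] -/
theorem smul_mem_apartment_of_mem_zpowers {t : unitaryGroupOfForm σ (!![0, 1; 1, 0] : Matrix (Fin 2) (Fin 2) E)}
    (ht : ((t : GL (Fin 2) E) : Matrix (Fin 2) (Fin 2) E) = Matrix.diagonal ![ϖ, (σ ϖ)⁻¹]) (s : ℤ)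
    (φ : Subgroup.zpowers (latticeTreePerm σ ϖ (!![0, 1; 1, 0] : Matrix (Fin 2) (Fin 2) E) t)) (v : {M : Submodule 𝒪[E] (Fin 2 → E) // IsSpecialLattice σ ϖ (!![0, 1; 1, 0] : Matrix (Fin 2) (Fin 2) E) M})
    (hv : ∃ a b : ℤ, a + b = s ∧ v.1 = latt (Matrix.diagonal ![ϖ ^ a, ϖ ^ b])) :
    ∃ a b : ℤ, a + b = s ∧ ((φ • v : {M : Submodule 𝒪[E] (Fin 2 → E) // IsSpecialLattice σ ϖ (!![0, 1; 1, 0] : Matrix (Fin 2) (Fin 2) E) M}) : Submodule 𝒪[E] (Fin 2 → E)) = latt (Matrix.diagonal ![ϖ ^ a, ϖ ^ b]) := by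
  obtain ⟨a, b, hab, hv⟩ := hv
  obtain ⟨n, hn⟩ := Subgroup.mem_zpowers_iff.1 φ.2
  refine ⟨a + n, b - n, by omega, ?_⟩
  rw [Subgroup.smul_def, Equiv.Perm.smul_def, ← hn]
  exact coe_latticeTreePerm_zpow_apply_of_eq_latt_diagonal σ hσv hϖ ht n v a b hv

include hσv hϖ in
/-- The translation group is TRANSITIVE on each colour class of the apartment. [cite: Serre1980Trees, I.6.4] -/
theorem exists_smul_eq_of_mem_apartment {t : unitaryGroupOfForm σ (!![0, 1; 1, 0] : Matrix (Fin 2) (Fin 2) E)}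
    (ht : ((t : GL (Fin 2) E) : Matrix (Fin 2) (Fin 2) E) = Matrix.diagonal ![ϖ, (σ ϖ)⁻¹]) (s : ℤ) (v w : {M : Submodule 𝒪[E] (Fin 2 → E) // IsSpecialLattice σ ϖ (!![0, 1; 1, 0] : Matrix (Fin 2) (Fin 2) E) M})
    (hv : ∃ a b : ℤ, a + b = s ∧ v.1 = latt (Matrix.diagonal ![ϖ ^ a, ϖ ^ b]))
    (hw : ∃ a b : ℤ, a + b = s ∧ w.1 = latt (Matrix.diagonal ![ϖ ^ a, ϖ ^ b])) :
    ∃ φ : Subgroup.zpowers (latticeTreePerm σ ϖ (!![0, 1; 1, 0] : Matrix (Fin 2) (Fin 2) E) t), φ • w = v := by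
  obtain ⟨a, b, hab, hv⟩ := hv
  obtain ⟨a', b', hab', hw⟩ := hw
  refine ⟨⟨latticeTreePerm σ ϖ (!![0, 1; 1, 0] : Matrix (Fin 2) (Fin 2) E) t ^ (a - a'), a - a', rfl⟩, Subtype.ext ?_⟩
  rw [Subgroup.smul_def, Equiv.Perm.smul_def, hv]
  change (((latticeTreePerm σ ϖ (!![0, 1; 1, 0] : Matrix (Fin 2) (Fin 2) E) t ^ (a - a')) w : {M : Submodule 𝒪[E] (Fin 2 → E) // IsSpecialLattice σ ϖ (!![0, 1; 1, 0] : Matrix (Fin 2) (Fin 2) E) M}) : Submodule 𝒪[E] (Fin 2 → E)) = _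
  rw [coe_latticeTreePerm_zpow_apply_of_eq_latt_diagonal σ hσv hϖ ht (a - a') w a' b' hw, show a' + (a - a') = a by ring,
    show b' - (a - a') = b by omega]

include hϖ in
/-- **A DIAGONAL `γ ∈ U(Φ)` WITH UNIT ENTRIES FIXES THE APARTMENT POINTWISE.** [cite: Serre1980Trees, II.1.1] [cite: BruhatTits1972, §7.4] -/
theorem latticeTreePerm_apply_eq_self_of_mem_apartment {γ : unitaryGroupOfForm σ (!![0, 1; 1, 0] : Matrix (Fin 2) (Fin 2) E)} {e : Fin 2 → E}
    (hγ : ((γ : GL (Fin 2) E) : Matrix (Fin 2) (Fin 2) E) = Matrix.diagonal e) (he : ∀ i, valuation E (e i) = 1) (v : {M : Submodule 𝒪[E] (Fin 2 → E) // IsSpecialLattice σ ϖ (!![0, 1; 1, 0] : Matrix (Fin 2) (Fin 2) E) M})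
    (hv : ∃ a b : ℤ, v.1 = latt (Matrix.diagonal ![ϖ ^ a, ϖ ^ b])) : latticeTreePerm σ ϖ (!![0, 1; 1, 0] : Matrix (Fin 2) (Fin 2) E) γ v = v := by
  obtain ⟨a, b, hv⟩ := hv
  apply Subtype.ext
  rw [coe_latticeTreePerm_apply, hv, mapGL_latt_diagonal_zpow_of_valuation_eq_one hϖ hγ he]

end Vertices

end Literature.NumberTheory.Automorphic.HermitianLatticeTree

end
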